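import Summits.QuantumFields.BalabanUV.Beta.FP.CoarseCovarianceStripBn

/-!
# `BalabanUV.Beta.FP.ResidualModeLocalLetters` — road «FP» (binder row D1), row H′2-IR ∕ IR-3-LOC (PREP): **THE GRADIENT IDENTITIES THAT MAKE
# THE RESIDUAL-MODE SYMBOL POLE-FREE** — `exC` annihilates gradients, `feynC(p)·d1C(p) = Δ¹(p)·d1C(p)`, the push-through form of `Bn⁻¹`, and
# **`d1C(−p)ᵀ·Bn⁻¹·feynC(p)·d1C(p) = Δ¹(p)²·(1 − d1C(−p)ᵀ·(1 + F̃·feynC(p))⁻¹·F̃·d1C(p))`** (exact divisibility by `Δ¹(p)²` of the quadratic form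
# of `Bn⁻¹feynC` on the fine gradient) — the heart of `L_C = d̂ᶜ†G_C d̂ᶜ ∝ Δ¹(k/n)²×(analytic)` (IR3-LOC-PREP v2 §3, leaf-06 lineage)

HONEST FRAMING (cell contract, verbatim): «discharging `BetaPertH` makes Bałaban's UV stability UNCONDITIONAL — a real constructive-QFT
result; it is NOT the continuum limit and NOT the Clay problem.»  HONEST DEPENDENCY (verbatim): «continuum YM on T⁴ ⇐ BetaPertH ∧ nine
spine estimates (0/9 proved); BetaPertH ⇐ (D1) ∧ (D4) ∧ CAP+tail; G-an2-4 gates asym, D1 and NE2/3/4.»  THIS MODULE DISCHARGES NOTHING of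
D1 ∕ BetaPertH: [folklore] finite-dimensional matrix algebra over the landed objects `exC`, `feynC`, `d1C` (`CoarseCovarianceStripFeyn`), `Bn`, `En`,
`Ftil`, `Dwi`, `Dwmi` (`CoarseCovarianceStrip`), `Bn_inv_bound` (`CoarseCovarianceStripBn`) and `PerfectPropagatorSymbol.sum_curlRow_mul` BY NAME;
Mathlib's `Matrix.det_one_add_mul_comm`.
[our object] one data def `Ft` (the `l ≠ 0` alias matrix between the inverse weights); no `def … : Prop`; nothing is cited; 0 sorry.
NOT summit progress; NOT hbook, NOT D1, NOT BetaPertH, NOT continuum, NOT Clay.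

ABSOLUTE RULE (cell, verbatim): «No internally-minted statement may enter as a cited fact. Every hypothesis is either kernel-proved in this
package or a verbatim quotation of a PUBLISHED theorem with page reference. The manuscript(s) under audit are NOT citable for their own
disputed steps — they are the thing under adjudication; programme-internal (2001/route/tribunal) claims are never citable.»

CONTENT: §1 `mul_pushThrough`, `isUnit_det_one_add_mul_comm`, **`inv_one_add_mul`** (`(1 + AB)⁻¹ = 1 − A(1 + BA)⁻¹B`); §2 **`exC_mulVec_d1C = 0`**,
**`d1C_neg_vecMul_exC = 0`**, `d1C_neg_dotProduct_d1C = Δ¹`, **`feynC_mulVec_d1C`**, **`d1C_neg_vecMul_feynC`**; §3 `Ft`, `Bn_eq_one_add`, `isUnit_det_one_add_Ft`,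
**`Bn_inv_pushThrough`**, **`quadForm_Bn_inv_feynC`**; §4 `d1C_eq_gsum_mul`, **`Dwi_mulVec_d1C`**∕`d1C_neg_vecMul_Dwmi` (the bond factor
of `cweight` cancels the coarse∕fine gradient ratio), **`quadForm_GC`** (`d1C(−k) ⬝ G_C·d1C(k) = N·(ΠgsumΠgsum(−))⁻¹·Δ¹(k/n)²·(1 − …)`),
**`quadForm_GC_strip`** (the same on `Strip D κ_C` with no side condition: `Bn_inv_bound`, `cw0_ne` BY NAME).
Unit `b2b-balaban-beta-d1-formalise-leaf-06` (gen 8), IR-3-LOC prep (first refusal leaf-06, LEAVES-FP l.277).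
-/

noncomputable section

namespace Summit.QuantumFields.BalabanUV.Beta.FP.ResidualModeLocalLetters

open Finset Complex Matrix
open scoped BigOperators
open Literature.MathematicalPhysics.QuantumFieldTheory.Balaban1983to89
open B4Strip (S1 Delta1)
open Summit.QuantumFields.BalabanUV.Beta.GAN24.AliasDecimate (aliasPt)
open Summit.QuantumFields.BalabanUV.Beta.FP.PerfectPropagatorSymbol (curlRow sum_curlRow_mul)
open Summit.QuantumFields.BalabanUV.Beta.FP.CoarseCovarianceStripFeyn
open Summit.QuantumFields.BalabanUV.Beta.FP.CoarseCovarianceStrip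
open Summit.QuantumFields.BalabanUV.Beta.FP.CoarseCovarianceStripAlias (rA rA_pos)
open Summit.QuantumFields.BalabanUV.Beta.FP.CoarseCovarianceStripBn (kapC kapC_le_rA Bn_inv_bound)

variable {d : ℕ}

/-! ## §1 Push-through -/

/-- [folklore] `(1 + AB)·(1 − A(1 + BA)⁻¹B) = 1` when `1 + BA` is invertible. -/
theorem mul_pushThrough {m : Type*} [Fintype m] [DecidableEq m] (A B : Matrix m m ℂ) (h : IsUnit (1 + B * A).det) :
    (1 + A * B) * (1 - A * (1 + B * A)⁻¹ * B) = 1 := by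
  have hinv : (1 + B * A) * (1 + B * A)⁻¹ = 1 := Matrix.mul_nonsing_inv _ h
  have key : (1 + A * B) * (A * (1 + B * A)⁻¹ * B) = A * B := by
    calc (1 + A * B) * (A * (1 + B * A)⁻¹ * B) = A * ((1 + B * A) * (1 + B * A)⁻¹) * B := by noncomm_ring
      _ = A * B := by rw [hinv, Matrix.mul_one]
  rw [Matrix.mul_sub, Matrix.mul_one, key, add_sub_cancel_right]

/-- [folklore] `det(1 + AB)` is a unit iff `det(1 + BA)` is (`Matrix.det_one_add_mul_comm`). -/
theorem isUnit_det_one_add_mul_comm {m : Type*} [Fintype m] [DecidableEq m] (A B : Matrix m m ℂ) (h : IsUnit (1 + B * A).det) :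
    IsUnit (1 + A * B).det := by
  rwa [Matrix.det_one_add_mul_comm]

/-- [folklore] **PUSH-THROUGH INVERSE**: `(1 + AB)⁻¹ = 1 − A·(1 + BA)⁻¹·B` when `1 + BA` is invertible. -/
theorem inv_one_add_mul {m : Type*} [Fintype m] [DecidableEq m] (A B : Matrix m m ℂ) (h : IsUnit (1 + B * A).det) :
    (1 + A * B)⁻¹ = 1 - A * (1 + B * A)⁻¹ * B :=
  Matrix.inv_eq_right_inv (mul_pushThrough A B h)

/-! ## §2 The Maxwell part annihilates gradients -/

/-- [folklore] **`exC V p` ANNIHILATES THE FINE GRADIENT SYMBOL**: `exC V p *ᵥ d1C p = 0` (`curl ∘ grad = 0` at symbol level). -/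
theorem exC_mulVec_d1C (V : Fin (d + 1) → Fin (d + 1) → ℂ) (p : Fin (d + 1) → ℂ) : exC V p *ᵥ d1C p = 0 := by
  have h0 : ∀ μ ν : Fin (d + 1), ∑ β, curlRow (d1C p) μ ν β * d1C p β = 0 := fun μ ν => by rw [sum_curlRow_mul]; ring
  funext α
  rw [Matrix.mulVec, dotProduct, Pi.zero_apply]
  calc ∑ β, exC V p α β * d1C p β
      = ∑ β, ∑ μ, ∑ ν, (if μ = ν then 0 else V μ ν / 2 * curlRow (d1C (-p)) μ ν α) * (curlRow (d1C p) μ ν β * d1C p β) := by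
        refine Finset.sum_congr rfl fun β _ => ?_
        rw [exC, Finset.sum_mul]
        refine Finset.sum_congr rfl fun μ _ => ?_
        rw [Finset.sum_mul]
        refine Finset.sum_congr rfl fun ν _ => ?_
        split_ifs <;> ring
    _ = ∑ μ, ∑ ν, (if μ = ν then 0 else V μ ν / 2 * curlRow (d1C (-p)) μ ν α) * ∑ β, curlRow (d1C p) μ ν β * d1C p β := by
        rw [Finset.sum_comm]
        refine Finset.sum_congr rfl fun μ _ => ?_
        rw [Finset.sum_comm]
        refine Finset.sum_congr rfl fun ν _ => ?_
        rw [Finset.mul_sum]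
    _ = 0 := by simp only [h0, mul_zero, Finset.sum_const_zero]

/-- [folklore] **THE REFLECTED GRADIENT ANNIHILATES `exC V p` FROM THE LEFT**: `d1C (−p) ᵥ* exC V p = 0`. -/
theorem d1C_neg_vecMul_exC (V : Fin (d + 1) → Fin (d + 1) → ℂ) (p : Fin (d + 1) → ℂ) : d1C (-p) ᵥ* exC V p = 0 := by
  have h0 : ∀ μ ν : Fin (d + 1), ∑ α, d1C (-p) α * curlRow (d1C (-p)) μ ν α = 0 := fun μ ν => by
    simp_rw [mul_comm (d1C (-p) _)]; rw [sum_curlRow_mul]; ring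
  funext β
  rw [Matrix.vecMul, dotProduct, Pi.zero_apply]
  calc ∑ α, d1C (-p) α * exC V p α β
      = ∑ α, ∑ μ, ∑ ν, (if μ = ν then 0 else V μ ν / 2 * curlRow (d1C p) μ ν β) * (d1C (-p) α * curlRow (d1C (-p)) μ ν α) := by
        refine Finset.sum_congr rfl fun α _ => ?_
        rw [exC, Finset.mul_sum]
        refine Finset.sum_congr rfl fun μ _ => ?_
        rw [Finset.mul_sum]
        refine Finset.sum_congr rfl fun ν _ => ?_
        split_ifs <;> ring
    _ = ∑ μ, ∑ ν, (if μ = ν then 0 else V μ ν / 2 * curlRow (d1C p) μ ν β) * ∑ α, d1C (-p) α * curlRow (d1C (-p)) μ ν α := by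
        rw [Finset.sum_comm]
        refine Finset.sum_congr rfl fun μ _ => ?_
        rw [Finset.sum_comm]
        refine Finset.sum_congr rfl fun ν _ => ?_
        rw [Finset.mul_sum]
    _ = 0 := by simp only [h0, mul_zero, Finset.sum_const_zero]

/-- [folklore] `d1C(−p)·d1C(p) = Δ¹(p)` (massless). -/
theorem d1C_neg_dotProduct_d1C (p : Fin (d + 1) → ℂ) : d1C (-p) ⬝ᵥ d1C p = Delta1 0 p := by
  rw [dotProduct, Delta1, Complex.ofReal_zero, add_zero]
  exact Finset.sum_congr rfl fun a _ => d1C_neg_mul_d1C p a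

/-- [folklore] **THE FINE GRADIENT IS AN EIGENVECTOR OF `feynC`**: `feynC p *ᵥ d1C p = Δ¹(p) • d1C p`. -/
theorem feynC_mulVec_d1C (p : Fin (d + 1) → ℂ) : feynC p *ᵥ d1C p = Delta1 0 p • d1C p := by
  have hex := exC_mulVec_d1C (fun μ ν => CoarseCovarianceStripW.Wper μ ν p) p
  funext α
  have hα := congrFun hex α
  rw [Matrix.mulVec, dotProduct, Pi.zero_apply] at hα
  rw [Matrix.mulVec, dotProduct, Pi.smul_apply, smul_eq_mul]
  have hsplit : ∑ β, feynC p α β * d1C p β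
      = ∑ β, exC (fun μ ν => CoarseCovarianceStripW.Wper μ ν p) p α β * d1C p β + d1C p α * ∑ β, d1C (-p) β * d1C p β := by
    rw [Finset.mul_sum, ← Finset.sum_add_distrib]
    refine Finset.sum_congr rfl fun β _ => ?_
    rw [feynC]; ring
  rw [hsplit, hα, zero_add, ← dotProduct, d1C_neg_dotProduct_d1C, mul_comm]

/-- [folklore] **… AND A LEFT EIGENVECTOR**: `d1C (−p) ᵥ* feynC p = Δ¹(p) • d1C (−p)`. -/
theorem d1C_neg_vecMul_feynC (p : Fin (d + 1) → ℂ) : d1C (-p) ᵥ* feynC p = Delta1 0 p • d1C (-p) := by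
  have hex := d1C_neg_vecMul_exC (fun μ ν => CoarseCovarianceStripW.Wper μ ν p) p
  funext β
  have hβ := congrFun hex β
  rw [Matrix.vecMul, dotProduct, Pi.zero_apply] at hβ
  rw [Matrix.vecMul, dotProduct, Pi.smul_apply, smul_eq_mul]
  have hsplit : ∑ α, d1C (-p) α * feynC p α β
      = ∑ α, d1C (-p) α * exC (fun μ ν => CoarseCovarianceStripW.Wper μ ν p) p α β + (∑ α, d1C (-p) α * d1C p α) * d1C (-p) β := by
    rw [Finset.sum_mul, ← Finset.sum_add_distrib]
    refine Finset.sum_congr rfl fun α _ => ?_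
    rw [feynC]; ring
  rw [hsplit, hβ, zero_add, ← dotProduct, d1C_neg_dotProduct_d1C]

/-! ## §3 The quadratic form of `Bn⁻¹·feynC` on the fine gradient -/

/-- [our object] the `l ≠ 0` alias matrix between the inverse weights: `Ft n k := Dwi₀·Ftil·Dwmi₀` (so that `En = feynC(k/n)·Ft`). -/
def Ft (n : ℕ) [NeZero n] (k : Fin (d + 1) → ℂ) : Matrix (Fin (d + 1)) (Fin (d + 1)) ℂ :=
  Dwi n (fun _ => (0 : Fin n)) k * Ftil n k * Dwmi n (fun _ => (0 : Fin n)) k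

/-- [folklore] `Bn = 1 + feynC(k/n)·Ft`. -/
theorem Bn_eq_one_add (n : ℕ) [NeZero n] (k : Fin (d + 1) → ℂ) :
    Bn n k = 1 + feynC (aliasPt n (fun _ => (0 : Fin n)) k) * Ft n k := by
  rw [Bn, En, Ft, ← Matrix.mul_assoc, ← Matrix.mul_assoc]

/-- [folklore] `Bn` invertible ⟹ `1 + Ft·feynC(k/n)` invertible (`det_one_add_mul_comm`). -/
theorem isUnit_det_one_add_Ft (n : ℕ) [NeZero n] {k : Fin (d + 1) → ℂ} (h : IsUnit (Bn n k).det) :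
    IsUnit (1 + Ft n k * feynC (aliasPt n (fun _ => (0 : Fin n)) k)).det := by
  rw [Bn_eq_one_add] at h
  rwa [Matrix.det_one_add_mul_comm] at h

/-- [folklore] **PUSH-THROUGH FORM OF `Bn⁻¹`**: `Bn⁻¹ = 1 − feynC(k/n)·(1 + Ft·feynC(k/n))⁻¹·Ft` wherever `Bn` is invertible. -/
theorem Bn_inv_pushThrough (n : ℕ) [NeZero n] {k : Fin (d + 1) → ℂ} (h : IsUnit (Bn n k).det) :
    (Bn n k)⁻¹ = 1 - feynC (aliasPt n (fun _ => (0 : Fin n)) k) * (1 + Ft n k * feynC (aliasPt n (fun _ => (0 : Fin n)) k))⁻¹ * Ft n k := by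
  rw [Bn_eq_one_add]
  exact inv_one_add_mul _ _ (isUnit_det_one_add_Ft n h)

/-- [folklore] **THE QUADRATIC FORM OF `Bn⁻¹·feynC` ON THE FINE GRADIENT IS EXACTLY DIVISIBLE BY `Δ¹(p)²`** (`p = k/n`):
`d1C(−p) ⬝ (Bn⁻¹·feynC p)·d1C(p) = Δ¹(p)²·(1 − d1C(−p) ⬝ ((1 + Ft·feynC p)⁻¹·Ft)·d1C(p))`, wherever `Bn` is invertible. -/
theorem quadForm_Bn_inv_feynC (n : ℕ) [NeZero n] {k : Fin (d + 1) → ℂ} (h : IsUnit (Bn n k).det) :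
    d1C (-(aliasPt n (fun _ => (0 : Fin n)) k)) ⬝ᵥ (((Bn n k)⁻¹ * feynC (aliasPt n (fun _ => (0 : Fin n)) k)) *ᵥ d1C (aliasPt n (fun _ => (0 : Fin n)) k))
      = Delta1 0 (aliasPt n (fun _ => (0 : Fin n)) k) ^ 2 *
        (1 - d1C (-(aliasPt n (fun _ => (0 : Fin n)) k)) ⬝ᵥ
          (((1 + Ft n k * feynC (aliasPt n (fun _ => (0 : Fin n)) k))⁻¹ * Ft n k) *ᵥ d1C (aliasPt n (fun _ => (0 : Fin n)) k))) := by
  set p := aliasPt n (fun _ => (0 : Fin n)) k with hp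
  set X := (1 + Ft n k * feynC p)⁻¹ * Ft n k with hX
  set Δ := Delta1 0 p with hΔ
  have hev : feynC p *ᵥ d1C p = Δ • d1C p := feynC_mulVec_d1C p
  have hlev : d1C (-p) ᵥ* feynC p = Δ • d1C (-p) := d1C_neg_vecMul_feynC p
  have hdd : d1C (-p) ⬝ᵥ d1C p = Δ := d1C_neg_dotProduct_d1C p
  rw [Bn_inv_pushThrough n h, Matrix.mul_assoc (feynC p), ← hX]
  -- ((1 - feynC p * X) * feynC p) *ᵥ d = feynC d - feynC (X (feynC d))
  rw [← Matrix.mulVec_mulVec, hev, Matrix.mulVec_smul, Matrix.sub_mulVec, Matrix.one_mulVec, ← Matrix.mulVec_mulVec, dotProduct_smul,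
    dotProduct_sub, hdd, Matrix.dotProduct_mulVec, hlev, smul_dotProduct, hΔ, smul_eq_mul, smul_eq_mul]
  ring

/-! ## §4 The alias weights cancel the coarse/fine gradient ratio; the coarse quadratic form of `G_C` -/

/-- [folklore] the coarse gradient symbol is the fine one times the bond sum: `e^{ik_κ} − 1 = gsum (k_κ/n) n·(e^{ik_κ/n} − 1)`. -/
theorem d1C_eq_gsum_mul (n : ℕ) [NeZero n] (k : Fin (d + 1) → ℂ) (κ : Fin (d + 1)) :
    d1C k κ = GAN24.FibreSymbols.gsum (aliasPt n (fun _ => (0 : Fin n)) k κ) n * d1C (aliasPt n (fun _ => (0 : Fin n)) k) κ := by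
  have hn : (n : ℂ) ≠ 0 := Nat.cast_ne_zero.mpr (NeZero.ne n)
  have hp : aliasPt n (fun _ => (0 : Fin n)) k κ = k κ / n := by
    rw [CoarseCovarianceStripAliasWeights.aliasPt_apply']; simp
  rw [d1C_apply, d1C_apply, mul_comm (aliasPt n (fun _ => (0 : Fin n)) k κ) I, GAN24.AliasStripSymbolsSum.gsum_mul_sub_one, hp]
  have e : I * (k κ / (n : ℂ)) * n = k κ * I := by rw [mul_assoc, div_mul_cancel₀ (k κ) hn, mul_comm]
  rw [e]

/-- [folklore] the reflected form: `e^{−ik_λ} − 1 = gsum (−k_λ/n) n·(e^{−ik_λ/n} − 1)`. -/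
theorem d1C_neg_eq_gsum_mul (n : ℕ) [NeZero n] (k : Fin (d + 1) → ℂ) (lam : Fin (d + 1)) :
    d1C (-k) lam = GAN24.FibreSymbols.gsum (-(aliasPt n (fun _ => (0 : Fin n)) k lam)) n * d1C (-(aliasPt n (fun _ => (0 : Fin n)) k)) lam := by
  have hn : (n : ℂ) ≠ 0 := Nat.cast_ne_zero.mpr (NeZero.ne n)
  have hp : aliasPt n (fun _ => (0 : Fin n)) k lam = k lam / n := by
    rw [CoarseCovarianceStripAliasWeights.aliasPt_apply']; simp
  rw [d1C_neg_apply, d1C_neg_apply, show -(aliasPt n (fun _ => (0 : Fin n)) k lam * I) = I * (-(aliasPt n (fun _ => (0 : Fin n)) k lam)) by ring,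
    GAN24.AliasStripSymbolsSum.gsum_mul_sub_one, hp]
  have e : I * (-(k lam / (n : ℂ))) * n = -(k lam * I) := by rw [mul_neg, neg_mul, mul_assoc, div_mul_cancel₀ (k lam) hn, mul_comm]
  rw [e]

/-- [folklore] **THE INVERSE WEIGHTS TURN THE COARSE GRADIENT INTO THE FINE ONE**: `Dwi₀ *ᵥ d1C k = (Π_i gsum (k_i/n) n)⁻¹ • d1C (k/n)`
(the bond factor `gsum (k_κ/n)` of `cweight n κ` cancels exactly), wherever the bond sums do not vanish. -/
theorem Dwi_mulVec_d1C (n : ℕ) [NeZero n] (k : Fin (d + 1) → ℂ)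
    (hg : ∀ κ, GAN24.FibreSymbols.gsum (aliasPt n (fun _ => (0 : Fin n)) k κ) n ≠ 0) :
    Dwi n (fun _ => (0 : Fin n)) k *ᵥ d1C k
      = (∏ i, GAN24.FibreSymbols.gsum (aliasPt n (fun _ => (0 : Fin n)) k i) n)⁻¹ • d1C (aliasPt n (fun _ => (0 : Fin n)) k) := by
  funext κ
  rw [Dwi, Matrix.mulVec_diagonal, Pi.smul_apply, smul_eq_mul, d1C_eq_gsum_mul n k κ, GAN24.PushSumSymbol.cweight, mul_inv]
  field_simp [hg κ]

/-- [folklore] the reflected form: `d1C (−k) ᵥ* Dwmi₀ = (Π_i gsum (−k_i/n) n)⁻¹ • d1C (−k/n)`. -/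
theorem d1C_neg_vecMul_Dwmi (n : ℕ) [NeZero n] (k : Fin (d + 1) → ℂ)
    (hg : ∀ lam, GAN24.FibreSymbols.gsum (-(aliasPt n (fun _ => (0 : Fin n)) k lam)) n ≠ 0) :
    d1C (-k) ᵥ* Dwmi n (fun _ => (0 : Fin n)) k
      = (∏ i, GAN24.FibreSymbols.gsum (-(aliasPt n (fun _ => (0 : Fin n)) k i)) n)⁻¹ • d1C (-(aliasPt n (fun _ => (0 : Fin n)) k)) := by
  funext lam
  rw [Dwmi, Matrix.vecMul_diagonal, Pi.smul_apply, smul_eq_mul, d1C_neg_eq_gsum_mul n k lam, GAN24.PushSumSymbol.cweight, mul_inv]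
  simp only [Pi.neg_apply]
  field_simp [hg lam]

/-- [our object] **THE COARSE QUADRATIC FORM OF `G_C` ON THE COARSE GRADIENT IS EXACTLY DIVISIBLE BY `Δ¹(k/n)²`**:
`d1C(−k) ⬝ (GC n k *ᵥ d1C k) = N·(Πgsum(−k/n))⁻¹·(Πgsum(k/n))⁻¹·Δ¹(k/n)²·(1 − d1C(−p) ⬝ ((1 + Ft·feynC p)⁻¹·Ft) *ᵥ d1C p)` (`p = k/n`,
`N = n^{3D+2}`), wherever `Bn` is invertible and the bond sums do not vanish — the symbol `L_C = d̂ᶜ†G_C d̂ᶜ` of IR3-DESIGN (I5) in pole-free form. -/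
theorem quadForm_GC (n : ℕ) [NeZero n] {k : Fin (d + 1) → ℂ} (h : IsUnit (Bn n k).det)
    (hg : ∀ κ, GAN24.FibreSymbols.gsum (aliasPt n (fun _ => (0 : Fin n)) k κ) n ≠ 0)
    (hg' : ∀ lam, GAN24.FibreSymbols.gsum (-(aliasPt n (fun _ => (0 : Fin n)) k lam)) n ≠ 0) :
    d1C (-k) ⬝ᵥ (GC n k *ᵥ d1C k)
      = ((n : ℂ) ^ (3 * (d + 1) + 2)) *
        ((∏ i, GAN24.FibreSymbols.gsum (-(aliasPt n (fun _ => (0 : Fin n)) k i)) n)⁻¹ *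
          (∏ i, GAN24.FibreSymbols.gsum (aliasPt n (fun _ => (0 : Fin n)) k i) n)⁻¹) *
        (Delta1 0 (aliasPt n (fun _ => (0 : Fin n)) k) ^ 2 *
          (1 - d1C (-(aliasPt n (fun _ => (0 : Fin n)) k)) ⬝ᵥ
            (((1 + Ft n k * feynC (aliasPt n (fun _ => (0 : Fin n)) k))⁻¹ * Ft n k) *ᵥ d1C (aliasPt n (fun _ => (0 : Fin n)) k)))) := by
  rw [← quadForm_Bn_inv_feynC n h, GC, Matrix.smul_mulVec, dotProduct_smul, smul_eq_mul, ← Matrix.mulVec_mulVec, Dwi_mulVec_d1C n k hg,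
    Matrix.mulVec_smul, dotProduct_smul, Matrix.mul_assoc (Dwmi n _ k), ← Matrix.mulVec_mulVec, Matrix.dotProduct_mulVec _ (Dwmi n _ k),
    d1C_neg_vecMul_Dwmi n k hg', smul_dotProduct, smul_eq_mul, smul_eq_mul]
  ring

/-- [our object] **… IN PARTICULAR ON THE THIN STRIP `Strip D κ_C` WITH NO SIDE CONDITION** (`Bn` is invertible there by `Bn_inv_bound`, and the
bond sums do not vanish on the fat region `Fat D rA ⊇ Strip D κ_C` by `cw0_ne`∕`cwm0_ne`). -/
theorem quadForm_GC_strip (n : ℕ) [NeZero n] {k : Fin (d + 1) → ℂ} (hk : k ∈ B4Strip.Strip (d + 1) (kapC d)) :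
    d1C (-k) ⬝ᵥ (GC n k *ᵥ d1C k)
      = ((n : ℂ) ^ (3 * (d + 1) + 2)) *
        ((∏ i, GAN24.FibreSymbols.gsum (-(aliasPt n (fun _ => (0 : Fin n)) k i)) n)⁻¹ *
          (∏ i, GAN24.FibreSymbols.gsum (aliasPt n (fun _ => (0 : Fin n)) k i) n)⁻¹) *
        (Delta1 0 (aliasPt n (fun _ => (0 : Fin n)) k) ^ 2 *
          (1 - d1C (-(aliasPt n (fun _ => (0 : Fin n)) k)) ⬝ᵥ
            (((1 + Ft n k * feynC (aliasPt n (fun _ => (0 : Fin n)) k))⁻¹ * Ft n k) *ᵥ d1C (aliasPt n (fun _ => (0 : Fin n)) k)))) := by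
  have hfat : k ∈ B4StripCauchy.Fat (d + 1) (rA d) := B4StripCauchy.strip_subset_fat (rA_pos d).le (kapC_le_rA d) hk
  refine quadForm_GC n (Bn_inv_bound n hk).1 (fun κ => ?_) (fun lam => ?_)
  · have h := cw0_ne n hfat κ
    rw [GAN24.PushSumSymbol.cweight] at h
    exact right_ne_zero_of_mul h
  · have h := cwm0_ne n hfat lam
    rw [GAN24.PushSumSymbol.cweight] at h
    exact right_ne_zero_of_mul h

end Summit.QuantumFields.BalabanUV.Beta.FP.ResidualModeLocalLetters

end
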